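import Summits.BirchSwinnertonDyer.Rank2.Family81517MinimalOrdinary
import HarnessLib

/-!
# Certified partners of Greenberg type B, I: the explicit family `W′_k` (cell `bsd-rank2`)

Cell `bsd-rank2` (D-0036), seat `bsd-rank2-lit` GEN 18, for the E1 line `refreduction` of route
`EisensteinDepletionAtTwo` (item `DepletedLambdaLawAtTwo`, planner p2 GEN 16): the CONSTRUCTIVE half of
its stub `stub_certifiedPartner` («for every curve `W` of the one-point type-A/B habitat there is a partner
`W′` of the same Greenberg type with the same `2`-division field, good ordinary at `2`, with a unique
rational `2`-torsion point»), in TYPE B («odd, not ramified at `2`»). This file: the member-wise facts of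
the explicit family; the companion `Rank2/CertifiedPartnerTypeB.lean` proves that every type-B curve has a
partner in it. Memo: `run/shared/lean/pub/bsd-rank2/lit/g17/E1-partner-families.md` (the family
`W′_B(D)`, here re-indexed by `32k + 17 = D·β²`; kit jobs j275709 / j275327).

PARTITION: none — r_an ≥ 2, summit axis S0; TWIN (D-0056): n/a. B1: explicit-model algebra (discriminant,
`c₄`, Silverman's minimality criterion, reduction mod `2`); no `L`-function, no Selmer group, no S0 motion.

## The family and the statements

For `k : ℤ` put `W′_k = ⟨1, −12k − 7, 0, (6k+3)², 0⟩ : y² + xy = x³ − (12k+7)x² + (6k+3)²x`. Then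
`Δ(W′_k) = 9·(32k+17)·(6k+3)⁴` (odd), `c₄(W′_k) = 9·(64k² + 96k + 33)`, and no prime `q` has
`q¹² ∣ Δ ∧ q⁴ ∣ c₄` (Bezout: `16·(64k²+96k+33) − (32k+31)(32k+17) = 1`,
`(64k²+96k+33) − (2k+1)(32k+32) = 1`, and `9 ∤ 64k²+96k+33`), so `W′_k` is a GLOBAL MINIMAL MODEL
(`isGloballyMinimal_partnerB`), an elliptic curve (`isElliptic_partnerB`), with GOOD ORDINARY reduction at
`2` (`isOrdinaryAt_two_partnerB`: `Δ` odd, reduction `y² + xy = x³ + x² + x` over `𝔽₂` with `2` points).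

No named fact, no `sorry`. Template: `Rank2/Family81517MinimalOrdinary.lean`.
-/

namespace Summit.BirchSwinnertonDyer.Rank2

open _root_.WeierstrassCurve
open Literature.NumberTheory.EllipticCurves
open Literature.NumberTheory.EllipticCurves.Rank1Residual.X11RankOneCertificates

section PartnerTypeBModel

/-! ### The integer model, its discriminant and `c₄` -/

/-- `Δ(⟨1, −12k−7, 0, (6k+3)², 0⟩) = 9(32k+17)(6k+3)⁴`. [folklore] -/
theorem partnerBInt_Δ (k : ℤ) :
    (⟨1, -12 * k - 7, 0, (6 * k + 3) ^ 2, 0⟩ : WeierstrassCurve ℤ).Δ =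
      9 * (32 * k + 17) * (6 * k + 3) ^ 4 := by
  simp only [WeierstrassCurve.Δ, WeierstrassCurve.b₂, WeierstrassCurve.b₄, WeierstrassCurve.b₆,
    WeierstrassCurve.b₈]
  ring

/-- `c₄(⟨1, −12k−7, 0, (6k+3)², 0⟩) = 9(64k² + 96k + 33)` (certificate schema's `c4Of`). [folklore] -/
theorem c4Of_partnerB (k : ℤ) :
    c4Of [1, -12 * k - 7, 0, (6 * k + 3) ^ 2, 0] = 9 * (64 * k ^ 2 + 96 * k + 33) := by
  simp only [c4Of, invariants]
  ring

/-- The rational model with all coefficients as integer casts. [folklore] -/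
theorem partnerB_model_eq_intCast (k : ℤ) :
    (⟨1, ((-12 * k - 7 : ℤ) : ℚ), 0, (((6 * k + 3) ^ 2 : ℤ) : ℚ), 0⟩ : WeierstrassCurve ℚ) =
      ⟨((1 : ℤ) : ℚ), ((-12 * k - 7 : ℤ) : ℚ), ((0 : ℤ) : ℚ), (((6 * k + 3) ^ 2 : ℤ) : ℚ),
        ((0 : ℤ) : ℚ)⟩ := by
  ext <;> simp

/-- The rational model is the base change of the integer model. [folklore] -/
theorem partnerBInt_baseChange (k : ℤ) :
    (⟨1, -12 * k - 7, 0, (6 * k + 3) ^ 2, 0⟩ : WeierstrassCurve ℤ).baseChange ℚ =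
      ⟨1, ((-12 * k - 7 : ℤ) : ℚ), 0, (((6 * k + 3) ^ 2 : ℤ) : ℚ), 0⟩ := by
  rw [baseChange_int_eq_map]
  ext <;> simp [WeierstrassCurve.map]

/-- The discriminant of the rational model. [folklore] -/
theorem partnerB_Δ (k : ℤ) :
    (⟨1, ((-12 * k - 7 : ℤ) : ℚ), 0, (((6 * k + 3) ^ 2 : ℤ) : ℚ), 0⟩ : WeierstrassCurve ℚ).Δ =
      9 * (32 * k + 17) * (6 * k + 3) ^ 4 := by
  simp only [WeierstrassCurve.Δ, WeierstrassCurve.b₂, WeierstrassCurve.b₄, WeierstrassCurve.b₆,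
    WeierstrassCurve.b₈]
  push_cast
  ring

/-! ### Parities -/

/-- `32k + 17`, `6k + 3` and `Δ = 9(32k+17)(6k+3)⁴` are odd. [folklore] -/
theorem odd_Δ_partnerB (k : ℤ) : Odd (9 * (32 * k + 17) * (6 * k + 3) ^ 4 : ℤ) := by
  have h9 : Odd (9 : ℤ) := by decide
  have h17 : Odd (32 * k + 17 : ℤ) := ⟨16 * k + 8, by ring⟩
  have h3 : Odd (6 * k + 3 : ℤ) := ⟨3 * k + 1, by ring⟩
  exact (h9.mul h17).mul h3.pow

/-- `Δ ≠ 0`. [folklore] -/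
theorem Δ_partnerB_ne_zero (k : ℤ) : (9 * (32 * k + 17) * (6 * k + 3) ^ 4 : ℤ) ≠ 0 := by
  intro h
  have := Int.odd_iff.mp (odd_Δ_partnerB k)
  rw [h] at this
  norm_num at this

/-! ### Silverman's criterion: no prime `q` with `q¹² ∣ Δ` and `q⁴ ∣ c₄` -/

/-- `9 ∤ 64k² + 96k + 33` (`≡ (k+3)² − 3 (mod 9)`). [folklore] -/
theorem not_nine_dvd_partnerB_c₄ (k : ℤ) : ¬ (9 : ℤ) ∣ 64 * k ^ 2 + 96 * k + 33 := by
  intro h9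
  have h3 : (3 : ℤ) ∣ 64 * k ^ 2 + 96 * k + 33 := dvd_trans ⟨3, by norm_num⟩ h9
  have hk2 : (3 : ℤ) ∣ k ^ 2 := by
    have hsplit : (64 * k ^ 2 + 96 * k + 33 : ℤ) = 3 * (21 * k ^ 2 + 32 * k + 11) + k ^ 2 := by ring
    rw [hsplit] at h3
    exact (dvd_add_right (Dvd.intro _ rfl)).mp h3
  obtain ⟨j, rfl⟩ := Int.prime_three.dvd_of_dvd_pow hk2
  have hsplit : (64 * (3 * j) ^ 2 + 96 * (3 * j) + 33 : ℤ) = 9 * (64 * j ^ 2 + 32 * j + 3) + 6 := by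
    ring
  rw [hsplit] at h9
  have h6 : (9 : ℤ) ∣ 6 := (dvd_add_right (Dvd.intro _ rfl)).mp h9
  omega

/-- **No prime `q` has `q¹² ∣ Δ(W′_k)` and `q⁴ ∣ c₄(W′_k)`** (Bezout certificates
`16(64k²+96k+33) − (32k+31)(32k+17) = 1`, `(64k²+96k+33) − (2k+1)(32k+32) = 1`). [folklore] -/
theorem not_pow_dvd_Δ_and_c₄_partnerB (k : ℤ) (q : ℕ) (hq : q.Prime) :
    ¬ ((q : ℤ) ^ 12 ∣ 9 * (32 * k + 17) * (6 * k + 3) ^ 4 ∧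
        (q : ℤ) ^ 4 ∣ 9 * (64 * k ^ 2 + 96 * k + 33)) := by
  rintro ⟨h12, h4⟩
  have hqp : Prime (q : ℤ) := Nat.prime_iff_prime_int.mp hq
  have hq1 : (q : ℤ) ∣ 9 * (32 * k + 17) * (6 * k + 3) ^ 4 :=
    dvd_trans (dvd_pow_self (q : ℤ) (by norm_num)) h12
  have hq2 : (q : ℤ) ∣ 9 * (64 * k ^ 2 + 96 * k + 33) :=
    dvd_trans (dvd_pow_self (q : ℤ) (by norm_num)) h4
  by_cases hq3 : q = 3
  · subst hq3
    obtain ⟨c, hc⟩ := h4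
    push_cast at hc
    have h9 : (9 : ℤ) ∣ 64 * k ^ 2 + 96 * k + 33 := ⟨c, by linarith⟩
    exact not_nine_dvd_partnerB_c₄ k h9
  · -- `q ≠ 3`, so `q ∤ 9`
    have hq9 : ¬ (q : ℤ) ∣ 9 := by
      intro h
      have h3 : (q : ℤ) ∣ 3 ^ 2 := by norm_num; exact h
      have h3' : (q : ℤ) ∣ 3 := hqp.dvd_of_dvd_pow h3
      have hq3' : q ∣ 3 := by exact_mod_cast h3'
      rcases (Nat.dvd_prime Nat.prime_three).mp hq3' with h1 | h1
      · exact hq.one_lt.ne' h1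
      · exact hq3 h1
    have hf : (q : ℤ) ∣ 64 * k ^ 2 + 96 * k + 33 := (hqp.dvd_or_dvd hq2).resolve_left hq9
    have hΔ : (q : ℤ) ∣ (32 * k + 17) * (6 * k + 3) ^ 4 := by
      rw [mul_assoc] at hq1
      exact (hqp.dvd_or_dvd hq1).resolve_left hq9
    rcases hqp.dvd_or_dvd hΔ with h17 | h63
    · -- `q ∣ 32k + 17` and `q ∣ 64k² + 96k + 33` force `q ∣ 1`
      have h1 : (q : ℤ) ∣ 16 * (64 * k ^ 2 + 96 * k + 33) - (32 * k + 31) * (32 * k + 17) :=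
        dvd_sub (dvd_mul_of_dvd_right hf _) (dvd_mul_of_dvd_right h17 _)
      have hone : (16 * (64 * k ^ 2 + 96 * k + 33) - (32 * k + 31) * (32 * k + 17) : ℤ) = 1 := by
        ring
      rw [hone] at h1
      exact hq.not_dvd_one (by exact_mod_cast h1)
    · -- `q ∣ 6k + 3 = 3(2k+1)`, `q ≠ 3`, so `q ∣ 2k + 1`, and then `q ∣ 1`
      have h63' : (q : ℤ) ∣ 3 * (2 * k + 1) := by
        have := hqp.dvd_of_dvd_pow h63
        rwa [show (6 * k + 3 : ℤ) = 3 * (2 * k + 1) by ring] at this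
      have h3 : ¬ (q : ℤ) ∣ 3 := fun h ↦ hq9 (dvd_trans h ⟨3, by norm_num⟩)
      have h21 : (q : ℤ) ∣ 2 * k + 1 := (hqp.dvd_or_dvd h63').resolve_left h3
      have h1 : (q : ℤ) ∣ (64 * k ^ 2 + 96 * k + 33) - (2 * k + 1) * (32 * k + 32) :=
        dvd_sub hf (dvd_mul_of_dvd_left h21 _)
      have hone : ((64 * k ^ 2 + 96 * k + 33) - (2 * k + 1) * (32 * k + 32) : ℤ) = 1 := by ring
      rw [hone] at h1
      exact hq.not_dvd_one (by exact_mod_cast h1)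

/-! ### Global minimality, the integral model, the minimal discriminant -/

/-- **`W′_k = ⟨1, −12k−7, 0, (6k+3)², 0⟩` is a global minimal model.**
[folklore: Silverman AEC VII.1 Remark 1.1, VIII.8] -/
theorem isGloballyMinimal_partnerB (k : ℤ) :
    (⟨1, ((-12 * k - 7 : ℤ) : ℚ), 0, (((6 * k + 3) ^ 2 : ℤ) : ℚ), 0⟩ :
      WeierstrassCurve ℚ).IsGloballyMinimal := by
  rw [partnerB_model_eq_intCast]
  refine isGloballyMinimal_of_int_criterion _ _ _ _ _ fun q hq hboth => ?_
  obtain ⟨h12, h4⟩ := hboth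
  rw [discOf_family81517, partnerBInt_Δ] at h12
  rw [c4Of_partnerB] at h4
  exact not_pow_dvd_Δ_and_c₄_partnerB k q hq ⟨h12, h4⟩

/-- The tree's integral model of `W′_k` is `⟨1, −12k−7, 0, (6k+3)², 0⟩` itself. [folklore] -/
theorem integralModelInt_partnerB (k : ℤ) :
    haveI := isGloballyMinimal_partnerB k
    integralModelInt (⟨1, ((-12 * k - 7 : ℤ) : ℚ), 0, (((6 * k + 3) ^ 2 : ℤ) : ℚ), 0⟩ :
      WeierstrassCurve ℚ) = ⟨1, -12 * k - 7, 0, (6 * k + 3) ^ 2, 0⟩ := by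
  haveI := isGloballyMinimal_partnerB k
  have key : ∀ (X : WeierstrassCurve ℚ) [X.IsGloballyMinimal],
      (⟨1, -12 * k - 7, 0, (6 * k + 3) ^ 2, 0⟩ : WeierstrassCurve ℤ).baseChange ℚ = X →
        integralModelInt X = ⟨1, -12 * k - 7, 0, (6 * k + 3) ^ 2, 0⟩ := by
    rintro X _ rfl
    exact integralModelInt_baseChange_int _
  exact key _ (partnerBInt_baseChange k)

/-- The minimal discriminant of `W′_k` is `9(32k+17)(6k+3)⁴`. [folklore] -/
theorem minimalDiscriminantInt_partnerB (k : ℤ) :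
    haveI := isGloballyMinimal_partnerB k
    minimalDiscriminantInt (⟨1, ((-12 * k - 7 : ℤ) : ℚ), 0, (((6 * k + 3) ^ 2 : ℤ) : ℚ), 0⟩ :
      WeierstrassCurve ℚ) = 9 * (32 * k + 17) * (6 * k + 3) ^ 4 := by
  rw [minimalDiscriminantInt, integralModelInt_partnerB, partnerBInt_Δ]

/-- `W′_k` is an elliptic curve (`Δ ≠ 0`). [folklore] -/
theorem isElliptic_partnerB (k : ℤ) :
    (⟨1, ((-12 * k - 7 : ℤ) : ℚ), 0, (((6 * k + 3) ^ 2 : ℤ) : ℚ), 0⟩ :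
      WeierstrassCurve ℚ).IsElliptic := by
  refine ⟨isUnit_iff_ne_zero.mpr ?_⟩
  rw [partnerB_Δ]
  exact_mod_cast Δ_partnerB_ne_zero k

/-! ### Good ordinary reduction at `2` -/

/-- **Good reduction at `2`** (`Δ` odd). [folklore: Silverman AEC VII.1 Remark 1.1] -/
theorem hasGoodReductionAtPrime_two_partnerB (k : ℤ) :
    haveI := isGloballyMinimal_partnerB k
    (⟨1, ((-12 * k - 7 : ℤ) : ℚ), 0, (((6 * k + 3) ^ 2 : ℤ) : ℚ), 0⟩ :
      WeierstrassCurve ℚ).HasGoodReductionAtPrime 2 := by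
  haveI := isGloballyMinimal_partnerB k
  refine hasGoodReductionAtPrime_of_not_dvd _ 2 ?_
  rw [minimalDiscriminantInt_partnerB]
  exact_mod_cast Int.two_dvd_ne_zero.mpr (Int.odd_iff.mp (odd_Δ_partnerB k))

/-- The reduction of the integral model modulo `2` is `⟨1, 1, 0, 1, 0⟩`. [folklore] -/
theorem partnerBInt_map_zmod_two (k : ℤ) :
    (⟨1, -12 * k - 7, 0, (6 * k + 3) ^ 2, 0⟩ : WeierstrassCurve ℤ).map (Int.castRingHom (ZMod 2)) =
      ⟨1, 1, 0, 1, 0⟩ := by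
  have h2 : ((2 : ℤ) : ZMod 2) = 0 := by decide
  have ha₂ : ((-12 * k - 7 : ℤ) : ZMod 2) = 1 := by
    rw [show (-12 * k - 7 : ℤ) = 2 * (-6 * k - 4) + 1 by ring, Int.cast_add, Int.cast_mul, h2,
      zero_mul, zero_add, Int.cast_one]
  have ha₄ : (((6 * k + 3) ^ 2 : ℤ) : ZMod 2) = 1 := by
    rw [show ((6 * k + 3) ^ 2 : ℤ) = 2 * (18 * k ^ 2 + 18 * k + 4) + 1 by ring, Int.cast_add,
      Int.cast_mul, h2, zero_mul, zero_add, Int.cast_one]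
  ext
  · show (Int.castRingHom (ZMod 2)) 1 = 1
    rw [map_one]
  · show (Int.castRingHom (ZMod 2)) (-12 * k - 7) = 1
    rw [eq_intCast, ha₂]
  · show (Int.castRingHom (ZMod 2)) 0 = 0
    rw [map_zero]
  · show (Int.castRingHom (ZMod 2)) ((6 * k + 3) ^ 2) = 1
    rw [eq_intCast, ha₄]
  · show (Int.castRingHom (ZMod 2)) 0 = 0
    rw [map_zero]

/-- **Ordinary at `2`**: `a₂(W′_k) = 3 − #W̃′(𝔽₂) ∈ {1, −1}` is odd. [folklore] -/
theorem not_two_dvd_frobeniusTrace_partnerB (k : ℤ) :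
    haveI := isGloballyMinimal_partnerB k
    ¬ ((2 : ℕ) : ℤ) ∣ frobeniusTrace (⟨1, ((-12 * k - 7 : ℤ) : ℚ), 0, (((6 * k + 3) ^ 2 : ℤ) : ℚ), 0⟩ :
      WeierstrassCurve ℚ) 2 := by
  haveI := isGloballyMinimal_partnerB k
  rw [frobeniusTrace, reductionPointCount, integralModelInt_partnerB, partnerBInt_map_zmod_two]
  rcases natCard_point_F2_family81517 (1 : ZMod 2) with h | h <;> rw [h] <;> norm_num

/-- **`W′_k` is good ordinary at `2`** (for the minimality instance above). [folklore] -/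
theorem isOrdinaryAt_two_partnerB (k : ℤ) :
    @IsOrdinaryAt (⟨1, ((-12 * k - 7 : ℤ) : ℚ), 0, (((6 * k + 3) ^ 2 : ℤ) : ℚ), 0⟩ : WeierstrassCurve ℚ)
      (isGloballyMinimal_partnerB k) 2 _ :=
  ⟨hasGoodReductionAtPrime_two_partnerB k, not_two_dvd_frobeniusTrace_partnerB k⟩

/-- The same, for ANY proof of global minimality (the predicate is proof-irrelevant in it). [folklore] -/
theorem isOrdinaryAt_two_partnerB' (k : ℤ)
    (hmin : (⟨1, ((-12 * k - 7 : ℤ) : ℚ), 0, (((6 * k + 3) ^ 2 : ℤ) : ℚ), 0⟩ :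
      WeierstrassCurve ℚ).IsGloballyMinimal) :
    @IsOrdinaryAt (⟨1, ((-12 * k - 7 : ℤ) : ℚ), 0, (((6 * k + 3) ^ 2 : ℤ) : ℚ), 0⟩ : WeierstrassCurve ℚ)
      hmin 2 _ :=
  isOrdinaryAt_two_partnerB k

end PartnerTypeBModel

end Summit.BirchSwinnertonDyer.Rank2
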